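/-
Copyright (c) 2026 the pub-hodgecm-mathlib formalisation cell (harness21).  Prover seat hodgecm-mathlib-K2-defs1 (g6), Track B, h413 = `stmt-HodgeConjecture-24833`, route `HCCMUnconditional`,
deal (261) of dealer K2E1-plan (g7) 2026-09-04T13:48:23Z («take ALL THREE generic-eigenvalue editions»): edition 0 — the `hL2` letter of the (χ,τ) uniqueness head in the EIGENVALUE currency.
-/
import Summits.HodgeConjecture.HodgeConjecture.Theorems.K2E1ChiHomogeneousL2U2   -- ★ (K2E1-p10): the ĥ-currency heads and ALL generic bricks (`exists_ae_norm_iota_le_of_homogeneous_vec`, …)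
import HarnessLib

/-!
# `K2E1ChiHomogeneousL2U2Eigen` — GENERIC-EIGENVALUE EDITION of ★ `K2E1ChiHomogeneousL2U2.hL2_chi_of_lt` ∕ `hL2_chi_cm_two`: the `L²`-letter of the (χ,τ) uniqueness head with the
# spherical transforms `∫ h_i·H^z dν_G` replaced by ARBITRARY eigenvalue functions `ŝ_i(z)` (K2E1-p14's currency finding R4; consumer: the eigen editions of hunq_χ and X1_χ §2c)

Cell `pub/hodgecm-mathlib`, crux H413 = `stmt-HodgeConjecture-24833`.  THEOREMS ONLY (no `def`, no `instance`, no notation, no named-fact hypothesis, no `sorry`); lane `--supports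
stmt-HodgeConjecture-24833 --as helper` (count-neutral).  Closes no socket.  THIS FILE = ★'s two heads VERBATIM with every `(∫ x, h i x * ↑↑(borelHeight x) ^ z ∂νG)` replaced by `ŝ i z`
for a family `ŝ : I → ℂ → ℂ`; ★'s proofs used the transform only as «a scalar `λ` with `Im λ ≠ 0` (hence `λ ≠ 0`) such that `T_{i₀} ψ = λ•ψ`» (★ `exists_ae_norm_iota_le_of_homogeneous_vec`),
so they go through unchanged. [BernsteinLapid2019, §4 Claim 2, Claims 4–5; MoeglinWaldspurger1995, I.4.10]
* **`hL2_chi_of_lt_of_eigen`** (generic `(F, E, c, N)`, threshold `σ₀`), **`hL2_chi_cm_two_of_eigen`** (CM, `N = 2`, `σ₀ = 1`, transfer discharged).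
HONEST LABEL: HC_CM is proved only modulo the 7 printed citations (2 remaining named inputs: hLiu418 = `stmt-HodgeConjecture-24832`, h413 = `stmt-HodgeConjecture-24833`) until rung 0
closes; count-neutral helper, closes no socket.

## References
* [BernsteinLapid2019] J. Bernstein, E. Lapid, *On the meromorphic continuation of Eisenstein series*, J. AMS 37 (2024), §4 Claim 2 (p. 9), Claims 4–5 (p. 10).
* [MoeglinWaldspurger1995] C. Mœglin, J.-L. Waldspurger, *Spectral Decomposition and Eisenstein Series* (1995), I.4.10.
-/

set_option autoImplicit false
set_option linter.dupNamespace false  -- the mandated namespace repeats the summit's segment (`HodgeConjecture.HodgeConjecture`)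

noncomputable section

open MeasureTheory MeasureTheory.Measure Set NumberField IsDedekindDomain Filter Topology Metric
open scoped NNReal ENNReal
open Literature.MeasureTheory.Group Literature.NumberTheory.Automorphic Literature.NumberTheory.Automorphic.UnitaryGroup AdelicGroupData
open Summit.HodgeConjecture.HodgeConjecture.Cruxes.H413.K2E1BLBorelSpacesU2Defs
open Summit.HodgeConjecture.HodgeConjecture.Cruxes.H413.K2E1BLBorelOperatorsU2Defs
open Summit.HodgeConjecture.HodgeConjecture.Cruxes.H413.K2E1BLHomogeneousL2U2 (ae_restrict_norm_comp_pZX_le memLp_two_of_ae_norm_comp_pZX_le_cm)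
open Summit.HodgeConjecture.HodgeConjecture.Cruxes.H413.K2E1ChiHomogeneousL2U2 (exists_ae_norm_iota_le_of_homogeneous_vec)

namespace Summit.HodgeConjecture.HodgeConjecture.Cruxes.H413.K2E1ChiHomogeneousL2U2Eigen

section Generic

variable {F E : Type} [Field F] [NumberField F] [Field E] [NumberField E] [Algebra F E] {c : E ≃ₐ[F] E} {N : ℕ} [NeZero N]
  [MeasurableSpace (quasiSplit F E c N).Adelic]
  {k : ℕ} {a a₀ : ℝ≥0} {μ : Measure (quasiSplit F E c N).automorphicQuotient} {μZ : Measure (borelQuotient F E c N)}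
  {νG : Measure (quasiSplit F E c N).Adelic}

/-- **GENERIC-EIGENVALUE EDITION of ★ `hL2_chi_of_lt`**: a homogeneous `(χ,τ)` solution — `T_i ψ = ŝ_i(z)•ψ` (any scalars `ŝ_i(z)`, `Im ŝ_{i₀}(z) ≠ 0`), `cnstN(ιψ) = L z b′`, `Q ψ = 0` — at a point of
the Godement part of the ball is in `L²(μ)`. [cite: BernsteinLapid2019, §4 Claim 2 (p. 9), Claims 4–5 (p. 10)] -/
theorem hL2_chi_of_lt_of_eigen (σ₀ : ℝ) (n : ℕ) {I : Type*} (i₀ : I) {hI : I → (quasiSplit F E c N).Adelic → ℂ} (ŝ : I → ℂ → ℂ)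
    (ha₀ : 0 < a₀) (haa₀ : a ≤ a₀) (hb : IotaBound F E c N k a μ μZ) (hs : ShiftBound F E c N k a a₀ νG μZ (hI i₀))
    (T : I → HX F E c N k μ →L[ℂ] HX F E c N k μ) (hδι : deltaShift hs ∘L iota hb = restrHN F E c N k haa₀ μZ ∘L iota hb ∘L T i₀)
    {C m : ℝ} (hC : 0 ≤ C) (hm : 0 ≤ m)
    (hK1 : ∀ f : HNcusp F E c N k a μZ, ∀ᵐ x ∂(weightedTruncMeasure F E c N k a₀ μZ),
      ‖rightConvFun F E c N νG (hI i₀) ((f : HN F E c N k a μZ) : borelQuotient F E c N → ℂ) x‖ ≤ C * ‖f‖ * ((borelQuotHeight F E c N x : ℝ)) ^ (-m))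
    {B : Type*} [NormedAddCommGroup B] [NormedSpace ℂ B] (L : ℂ → B →L[ℂ] HN F E c N k a μZ)
    (hδL : ∀ z ∈ ball (0 : ℂ) (n + 2), σ₀ < z.re → ∀ b' : B,
      ∃ M : ℝ, ∀ᵐ x ∂(weightedTruncMeasure F E c N k a₀ μZ), ‖(deltaShift hs (L z b') : borelQuotient F E c N → ℂ) x‖ ≤ M)
    (htr : ∀ (ψ : HX F E c N k μ) (M : ℝ), (∀ᵐ x ∂(μZ.restrict {x | a₀ < borelQuotHeight F E c N x}),
      ‖(ψ : (quasiSplit F E c N).automorphicQuotient → ℂ) (pZX F E c N x)‖ ≤ M) → MemLp (ψ : (quasiSplit F E c N).automorphicQuotient → ℂ) 2 μ)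
    {X' : Type*} [NormedAddCommGroup X'] [NormedSpace ℂ X'] (Q : HX F E c N k μ →L[ℂ] X') :
    ∀ z ∈ ball (0 : ℂ) (n + 2), σ₀ < z.re → (ŝ i₀ z).im ≠ 0 →
      ∀ (ψ : HX F E c N k μ) (b' : B), (∀ i, T i ψ = (ŝ i z) • ψ) →
        cnstN F E c N k a μZ (iota hb ψ) = L z b' → Q ψ = 0 → MemLp (ψ : (quasiSplit F E c N).automorphicQuotient → ℂ) 2 μ := by
  intro z hzb hzσ hzim ψ b' hTψ hP _
  obtain ⟨M₁, hM₁⟩ := hδL z hzb hzσ b'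
  have hlam : (ŝ i₀ z) ≠ 0 := fun h0 => hzim (by rw [h0, Complex.zero_im])
  obtain ⟨M, hM⟩ := exists_ae_norm_iota_le_of_homogeneous_vec ha₀ haa₀ hb hs hδι (hTψ i₀) hlam hP hC hm hK1 hM₁
  exact htr ψ M (ae_restrict_norm_comp_pZX_le haa₀ hb hM)

end Generic

section CM

variable (L : Type) [Field L] [NumberField L] [IsCMField L]
  [MeasurableSpace (quasiSplit (↥(maximalRealSubfield L)) L (IsCMField.complexConj L) 2).Adelic]
  [BorelSpace (quasiSplit (↥(maximalRealSubfield L)) L (IsCMField.complexConj L) 2).Adelic]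

/-- **GENERIC-EIGENVALUE EDITION of ★ `hL2_chi_cm_two`** (CM pair, `N = 2`, `σ₀ = 1`, transfer discharged by ★ `memLp_two_of_ae_norm_comp_pZX_le_cm`): the `hL2` slot of the eigen edition of
`hunq_of_memLp_two_finDim`, byte-for-byte with `ŝ i z` in place of `∫ h_i·H^z`. [cite: BernsteinLapid2019, §4 Claim 2 (p. 9), Claims 4–5 (p. 10)] [cite: MoeglinWaldspurger1995, I.4.10] -/
theorem hL2_chi_cm_two_of_eigen
    (μ : Measure (quasiSplit (↥(maximalRealSubfield L)) L (IsCMField.complexConj L) 2).automorphicQuotient)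
    [(quasiSplit (↥(maximalRealSubfield L)) L (IsCMField.complexConj L) 2).IsAutomorphicMeasure μ]
    (νG : Measure (quasiSplit (↥(maximalRealSubfield L)) L (IsCMField.complexConj L) 2).Adelic) [νG.IsHaarMeasure] [νG.IsInvInvariant]
    {β : (quasiSplit (↥(maximalRealSubfield L)) L (IsCMField.complexConj L) 2).Adelic → ℝ≥0∞}
    (hβ : IsCoveringWeight ↥((arithmeticBorel (↥(maximalRealSubfield L)) L (IsCMField.complexConj L) 2).map
      (quasiSplit (↥(maximalRealSubfield L)) L (IsCMField.complexConj L) 2).arithmeticSubgroup.subtype) β)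
    {μZ : Measure (borelQuotient (↥(maximalRealSubfield L)) L (IsCMField.complexConj L) 2)}
    (hμZ : ∀ f : borelQuotient (↥(maximalRealSubfield L)) L (IsCMField.complexConj L) 2 → ℝ≥0∞, Measurable f →
      ∫⁻ z, f z ∂μZ = ∫⁻ g, β g * f (toBorelQuotient (↥(maximalRealSubfield L)) L (IsCMField.complexConj L) 2 g) ∂νG)
    (k n : ℕ) {I : Type*} (i₀ : I) {h : I → (quasiSplit (↥(maximalRealSubfield L)) L (IsCMField.complexConj L) 2).Adelic → ℂ} (ŝ : I → ℂ → ℂ)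
    {a a₀ : ℝ≥0} (ha₀ : 0 < a₀) (haa₀ : a ≤ a₀) (hfin : μZ {z | a < borelQuotHeight (↥(maximalRealSubfield L)) L (IsCMField.complexConj L) 2 z} ≠ ∞)
    (hb : IotaBound (↥(maximalRealSubfield L)) L (IsCMField.complexConj L) 2 k a μ μZ)
    (hs : ShiftBound (↥(maximalRealSubfield L)) L (IsCMField.complexConj L) 2 k a a₀ νG μZ (h i₀))
    (T : I → HX (↥(maximalRealSubfield L)) L (IsCMField.complexConj L) 2 k μ →L[ℂ] HX (↥(maximalRealSubfield L)) L (IsCMField.complexConj L) 2 k μ)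
    (hδι : deltaShift hs ∘L iota hb = restrHN (↥(maximalRealSubfield L)) L (IsCMField.complexConj L) 2 k haa₀ μZ ∘L iota hb ∘L T i₀)
    {C m : ℝ} (hC : 0 ≤ C) (hm : 0 ≤ m)
    (hK1 : ∀ f : HNcusp (↥(maximalRealSubfield L)) L (IsCMField.complexConj L) 2 k a μZ,
      ∀ᵐ x ∂(weightedTruncMeasure (↥(maximalRealSubfield L)) L (IsCMField.complexConj L) 2 k a₀ μZ),
        ‖rightConvFun (↥(maximalRealSubfield L)) L (IsCMField.complexConj L) 2 νG (h i₀)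
            ((f : HN (↥(maximalRealSubfield L)) L (IsCMField.complexConj L) 2 k a μZ) : borelQuotient (↥(maximalRealSubfield L)) L (IsCMField.complexConj L) 2 → ℂ) x‖ ≤
          C * ‖f‖ * ((borelQuotHeight (↥(maximalRealSubfield L)) L (IsCMField.complexConj L) 2 x : ℝ)) ^ (-m))
    {B : Type*} [NormedAddCommGroup B] [NormedSpace ℂ B] (Lz : ℂ → B →L[ℂ] HN (↥(maximalRealSubfield L)) L (IsCMField.complexConj L) 2 k a μZ)
    (hδL : ∀ z ∈ ball (0 : ℂ) (n + 2), 1 < z.re → ∀ b' : B, ∃ M : ℝ, ∀ᵐ x ∂(weightedTruncMeasure (↥(maximalRealSubfield L)) L (IsCMField.complexConj L) 2 k a₀ μZ),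
      ‖(deltaShift hs (Lz z b') : borelQuotient (↥(maximalRealSubfield L)) L (IsCMField.complexConj L) 2 → ℂ) x‖ ≤ M)
    {X' : Type*} [NormedAddCommGroup X'] [NormedSpace ℂ X'] (Q : HX (↥(maximalRealSubfield L)) L (IsCMField.complexConj L) 2 k μ →L[ℂ] X') :
    ∀ z ∈ ball (0 : ℂ) (n + 2), 1 < z.re → (ŝ i₀ z).im ≠ 0 →
      ∀ (ψ : HX (↥(maximalRealSubfield L)) L (IsCMField.complexConj L) 2 k μ) (b' : B),
        (∀ i, T i ψ = (ŝ i z) • ψ) →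
          cnstN (↥(maximalRealSubfield L)) L (IsCMField.complexConj L) 2 k a μZ (iota hb ψ) = Lz z b' → Q ψ = 0 →
            MemLp (ψ : (quasiSplit (↥(maximalRealSubfield L)) L (IsCMField.complexConj L) 2).automorphicQuotient → ℂ) 2 μ :=
  have hfin₀ : μZ {z | a₀ < borelQuotHeight (↥(maximalRealSubfield L)) L (IsCMField.complexConj L) 2 z} ≠ ∞ :=
    ((measure_mono fun _ hz => lt_of_le_of_lt haa₀ hz).trans_lt (lt_top_iff_ne_top.2 hfin)).ne
  hL2_chi_of_lt_of_eigen 1 n i₀ ŝ ha₀ haa₀ hb hs T hδι hC hm hK1 Lz hδL (fun ψ _ hM => memLp_two_of_ae_norm_comp_pZX_le_cm L μ νG hβ hμZ k ψ ha₀ hfin₀ hM) Q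

end CM

end Summit.HodgeConjecture.HodgeConjecture.Cruxes.H413.K2E1ChiHomogeneousL2U2Eigen
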